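import Mathlib
import HarnessLib
import Literature.AlgebraicGeometry.HyperbolicPolynomials.SpectrahedralShadow
import Summits.ValiantsHypothesis.ValiantsHypothesis.Theorems.PermanentalConesHyperbolicVPShadowSymmetricCase

/-!
# ValiantsHypothesis / PermanentalCones — `HyperbolicVPShadow`, stub `stub_spectrahedron_of_symmDetPower`

Route `PermanentalCones`, item `stmt-ValiantsHypothesis-8655` (crux `HyperbolicVPShadow`), line
`birth`, stub `stub_spectrahedron_of_symmDetPower` (a symmetric determinantal representation of a
POWER of `det (P x + τ·1)` makes the nonnegative-spectrum cone a size-`M` spectrahedron).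

If `P` is a linear pencil of real `N × N` matrices, `L` a linear pencil of real SYMMETRIC `M × M`
matrices, `k ≥ 1`, and `det (L x + τ·1_M) = det (P x + τ·1_N) ^ k` for all `x, τ`, then for every
`τ` we have `det (P x + τ·1) ≠ 0 ↔ det (P x + τ·1) ^ k ≠ 0 ↔ det (L x + τ·1) ≠ 0`
(`pow_ne_zero_iff`), so the closed "nonnegative spectrum" cone `{x : ∀ τ > 0, det (P x + τ·1) ≠ 0}`
of `P` coincides with that of `L`, and the latter is the spectrahedron `{x : L x ⪰ 0}`, a
lifted-LMI set of size `M` (`permanentalCones_realSpectrumShadow_symmetric`). This is the landing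
pad through which a definite HERMITIAN determinantal representation of `det (t·1 + P x)` enters
after realification (`k = 2`, `M = 2N`).
-/

-- `<Problem> = <Summit>` for this single-conjunct summit (lakefile sets the same option tree-wide).
set_option linter.dupNamespace false

namespace Summit.ValiantsHypothesis.ValiantsHypothesis.Theorems

open Matrix

/-- **Stub (symmetric determinantal representation of a power ⇒ spectrahedron).** If `L` is a
linear pencil of real symmetric `M × M` matrices, `k ≠ 0`, and
`det (L x + τ·1_M) = det (P x + τ·1_N) ^ k` for all `x, τ`, then the closed nonnegative-spectrum
cone `{x : ∀ τ > 0, det (P x + τ·1) ≠ 0}` of `P` is the spectrahedron `{x : L x ⪰ 0}`, a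
lifted-LMI set of size `M` (no lifting variables). [folklore] -/
theorem stub_spectrahedron_of_symmDetPower :
    ∀ (n N M k : ℕ) (P : (Fin n → ℝ) →ₗ[ℝ] Matrix (Fin N) (Fin N) ℝ)
      (L : (Fin n → ℝ) →ₗ[ℝ] Matrix (Fin M) (Fin M) ℝ), k ≠ 0 →
      (∀ x : Fin n → ℝ, (L x).IsSymm) →
      (∀ (x : Fin n → ℝ) (τ : ℝ), (L x + τ • (1 : Matrix (Fin M) (Fin M) ℝ)).det =
        ((P x + τ • (1 : Matrix (Fin N) (Fin N) ℝ)).det) ^ k) →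
      Literature.AlgebraicGeometry.HyperbolicPolynomials.IsSpectrahedralShadowOfSize
        {x : Fin n → ℝ | ∀ τ : ℝ, 0 < τ → (P x + τ • (1 : Matrix (Fin N) (Fin N) ℝ)).det ≠ 0} M := by
  intro n N M k P L hk hL hPL
  obtain ⟨p, A, B, h⟩ := permanentalCones_realSpectrumShadow_symmetric n M L hL
  refine ⟨p, A, B, fun x => ?_⟩
  rw [← h x, Set.mem_setOf_eq]
  simp only [hPL, pow_ne_zero_iff hk]

end Summit.ValiantsHypothesis.ValiantsHypothesis.Theorems
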